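import Summits.HubbardSuperconductivity.HubbardSuperconductivity.Theorems.AnisotropyChordTransferFibre3KT1Targets

/-!
# Route `AnisotropyChord` / H0 rotor rung: PORT PartN37 — FAMILY A, THE KERNEL WINDOW: exact λ-harmonicity, the diagonal row formula, shifted ring resolvent sums, the ℤ² window in closed form, the measured window enclosures, and (v2) the torus difference bounds

Verbatim port (modulo this header, the port comment and lint options) of the theory seat's statement file
`hubbard-h0-rotor-theory-1/cycle21/lean/PartN37.lean` (sha16 `f8e89b7f8a777870`, v2; theory seat `hubbard-h0-rotor-theory-1` g21,
REPORT 27/31, memo ROTOR-THEORY-21 §315/§329; THEOREMS M130).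
Statements (`def … : Prop` targets typed by the theory seat) plus the one lemma the theory file itself proves
(`kernelAxisValue_of_harmonicity`); no further proof claimed here.  The objects `gres`/`Gres`/`aKer` are declared HERE once, in the
top `…Fibre3` namespace (PORT-INDEX: PartN39's `RateLemma.gres/Gres/aKer` duplicate them with identical bodies and are to `open` these;
PartN35's `gsymb`/`Gfun` have the same formulas and are to be identified with these on porting).
Prover seat `hubbard-h0-rotor-p2` g0; helper for stmt-HubbardSuperconductivity-19089 (`--supports`, helper class).
WHAT THIS IS NOT: nothing here proves superconductivity in the Hubbard model; the rotor TARGET as originally worded stays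
FALSE (g15 verdict) — these are helper statements of ONE conditional reduction (rung 19089: GM₃ ∀L certificate, spectral input
HOLE₂(.75); family-A one-body lattice sums).  The MEASURED ENCLOSURES (`TorusKernelQuadraticLaw`, `HoleTwoRegimeWindow`,
`GzeroHoleTwoRegime`, `TorusGradientBound`, `TorusHessian*`) are numerical targets typed by the theory seat, NOT claimed proved.
Mathlib + the KT1 targets layer only; no sorry, no axioms.

Theory seat's own summary of the file:

# PartN37 — FAMILY A, THE KERNEL WINDOW: exact λ-harmonicity, the diagonal row formula, shifted ring resolvent sums,
# the ℤ² window in closed form, and the two measured window enclosures (memo ROTOR-THEORY-21 §315; THEOREMS M130)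

The potential-kernel differences `a_L(r;λ) := G̃_λ(0) − G̃_λ(r)` of the zero-mode-removed torus resolvent
`G̃_λ(r) = (1/V) Σ_{k≠0} cos(k·r)/(2ε(k) − λ)` (KT normalisation; the rate-½ walk kernel is `2·a`, the simple-random-walk
kernel is `4·a`) are the ONLY one-body inputs of (i) the Level-2 window quantities of the GM₃ certificate and (ii) the two-hole
Birman–Schwinger matrix of HOLE₂ (memo §314).  This file records, as `Prop`s over existing declarations:
* `KernelHarmonicity` — `Σ_e a(x+e) = 4a(x) + δ_{x0} − 1/V + λ(G̃(0) − a(x))` (exact; from `(4−λ)G̃(x) − Σ_e G̃(x+e) = δ_{x0} − 1/V`),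
  and its corollary `KernelAxisValue`: `a(1,0) = (1 − 1/V + λG̃(0))/4`;
* `DiagRotation` — the diagonal values `a(n,n)` as a rotated double sum whose inner sums are SHIFTED RING RESOLVENT SUMS
  (`RingResolventSumShift`, `RingResolventSumShiftTrig`, closed forms), i.e. an exact O(L) «diagonal row formula»
  (cycle21/calc/diag_row.py: 2e-15 against the 2D definition in both regimes); with `KernelHarmonicity` the four numbers
  `{G̃(0), a(1,1), a(2,2), a(3,3)}` determine the whole window `|r|∞ ≤ 3` by exact algebra (recursion checked to 3e-15);
* `aInfKT` — the ℤ² potential kernel on the window in closed form (`= a_SRW/4`);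
* MEASURED ENCLOSURES (targets for the Level-2 / HOLE₂-∞ analytic regime, not claimed proved; constants from diag_row.py,
  L = 16…1024): `TorusKernelQuadraticLaw` (`λ = 0`: `V(a_L − a_∞) = −|r|²/4 + O(|r|⁴/V)`), `HoleTwoRegimeWindow`
  (`λ = (3/2)ε₁`, the HOLE₂(.75) point: `0 ≤ a_L − a_∞ ≤ 24 ln L/L²`), `GzeroHoleTwoRegime` (`G̃(0) = ln L/2π + .4053 ± …`).
`gres`/`Gres` below coincide with PartN35's `gsymb`/`Gfun` (same formulas); on porting, identify them.  Mathlib + the KT1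
targets layer only (for `Tor`, `epsT`, `eps1`, `phase`, `nnList`).
-/

-- Port of theory seat `hubbard-h0-rotor-theory-1` cycle21/lean/PartN37.lean (sha16 f8e89b7f8a777870) verbatim modulo this header,
-- lint options and lint fixes; prover seat `hubbard-h0-rotor-p2` g0, `--supports stmt-HubbardSuperconductivity-19089`.

set_option linter.dupNamespace false
noncomputable section

open scoped BigOperators
open Complex

namespace Summit.HubbardSuperconductivity.HubbardSuperconductivity.Theorems.AnisotropyChord.Transfer.Fibre3

variable (L : ℕ) [NeZero L]

/-! ## Objects -/

/-- zero-mode-removed resolvent symbol `g(k) = 1/(2ε(k) − λ)`, `g(0) := 0` (= PartN35 `gsymb`). -/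
def gres (lam2 : ℝ) (k : Tor L) : ℝ := if k = 0 then 0 else 1 / (2 * epsT L k - lam2)

/-- `G̃_λ(r) = (1/V) Σ_{k≠0} cos(k·r) g(k)` (= PartN35 `Gfun`). -/
def Gres (lam2 : ℝ) (r : Tor L) : ℝ := (∑ k : Tor L, gres L lam2 k * (phase L k r).re) / (L : ℝ) ^ 2

/-- potential-kernel differences `a_L(r;λ) = G̃_λ(0) − G̃_λ(r)` (≥ 0, even, `a(0) = 0`). -/
def aKer (lam2 : ℝ) (r : Tor L) : ℝ := Gres L lam2 0 - Gres L lam2 r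

/-! ## Exact identities -/

/-- λ-HARMONICITY OF THE KERNEL (exact, every `0 ≤ λ < 2ε₁`, every site):
`Σ_{e} a(x+e) = 4 a(x) + δ_{x,0} − 1/V + λ (G̃(0) − a(x))`
(from `(4 − λ)G̃(x) − Σ_e G̃(x+e) = δ_{x,0} − 1/V`; the `−1/V` is the removed zero mode). -/
def KernelHarmonicity : Prop :=
  ∀ lam2 : ℝ, 0 ≤ lam2 → lam2 < 2 * eps1 L → ∀ x : Tor L,
    ((nnList L).map (fun e => aKer L lam2 (x + e))).sum
      = 4 * aKer L lam2 x + (if x = 0 then (1 : ℝ) else 0) - 1 / (L : ℝ) ^ 2 + lam2 * (Gres L lam2 0 - aKer L lam2 x)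

/-- corollary at `x = 0` (by the symmetry `a(±e) = a(e₁)`): `a(1,0) = (1 − 1/V + λ G̃(0))/4`. -/
def KernelAxisValue : Prop :=
  ∀ lam2 : ℝ, 0 ≤ lam2 → lam2 < 2 * eps1 L →
    aKer L lam2 ((1 : ZMod L), 0) = (1 - 1 / (L : ℝ) ^ 2 + lam2 * Gres L lam2 0) / 4

/-- SHIFTED RING RESOLVENT SUM (hyperbolic): for `μ > 0` and any phase `φ`,
`Σ_{j ∈ ℤ/L} 1/(cosh μ − cos(2πj/L + φ)) = L sinh(Lμ) / (sinh μ (cosh(Lμ) − cos(Lφ)))`. -/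
def RingResolventSumShift : Prop :=
  ∀ μ : ℝ, 0 < μ → ∀ φ : ℝ,
    (∑ j : ZMod L, 1 / (Real.cosh μ - Real.cos (2 * Real.pi * j.val / L + φ)))
      = L * Real.sinh (L * μ) / (Real.sinh μ * (Real.cosh (L * μ) - Real.cos (L * φ)))

/-- SHIFTED RING RESOLVENT SUM (trigonometric continuation `μ = iα`): if `sin α ≠ 0`, `cos(Lα) ≠ cos(Lφ)` and no
denominator vanishes, `Σ_{j} 1/(cos α − cos(2πj/L + φ)) = L sin(Lα) / (sin α (cos(Lα) − cos(Lφ)))`. -/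
def RingResolventSumShiftTrig : Prop :=
  ∀ α φ : ℝ, Real.sin α ≠ 0 → Real.cos (L * α) ≠ Real.cos (L * φ) →
    (∀ j : ZMod L, Real.cos α ≠ Real.cos (2 * Real.pi * j.val / L + φ)) →
      (∑ j : ZMod L, 1 / (Real.cos α - Real.cos (2 * Real.pi * j.val / L + φ)))
        = L * Real.sin (L * α) / (Real.sin α * (Real.cos (L * α) - Real.cos (L * φ)))

/-- DIAGONAL ROTATION (exact): with `u = π p/L`, `v = π q/L`, `q ≡ p (mod 2)`, `2cos kₓ + 2cos k_y = 4 cos u cos v` and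
`cos(n(kₓ+k_y)) = cos(2πnp/L)`; each `k` is hit twice by `(p,q) ∈ (ℤ/2L)²`, `q = 2j + (p mod 2)`:
`2V · a(n,n) = Σ_{p=0}^{2L−1} (1 − cos(2πnp/L)) · Σ_{j=0}^{L−1} 1/(4 − λ − 4 cos(πp/L) cos(π(2j + p mod 2)/L))`.
(The rows `p = 0`, `p = L` carry the zero modes and have vanishing prefactor.)  The inner sums are `RingResolventSumShift`
(rows with `4|cos(πp/L)| < 4 − λ`) or `RingResolventSumShiftTrig` (the rows `|p| ≤ p₀`, sub-threshold), giving the O(L)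
DIAGONAL ROW FORMULA (diag_row.py). -/
def DiagRotation : Prop :=
  ∀ lam2 : ℝ, 0 < lam2 → lam2 < 2 * eps1 L → ∀ n : ℕ,
    2 * (L : ℝ) ^ 2 * aKer L lam2 ((n : ZMod L), (n : ZMod L))
      = ∑ p ∈ Finset.range (2 * L),
          (1 - Real.cos (2 * Real.pi * n * p / L))
            * ∑ j ∈ Finset.range L,
                1 / (4 - lam2 - 4 * Real.cos (Real.pi * p / L) * Real.cos (Real.pi * (2 * j + p % 2) / L))

/-! ## The ℤ² window in closed form (KT normalisation = a_SRW/4) -/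

/-- `a_∞(x,y)` for `0 ≤ y ≤ x ≤ 3`: `a(1,0) = 1/4`, `a(1,1) = 1/π`, `a(2,0) = 1 − 2/π`, `a(2,1) = 2/π − 1/4`, `a(2,2) = 4/(3π)`,
`a(3,0) = 17/4 − 12/π`, `a(3,1) = 23/(3π) − 2`, `a(3,2) = 2/(3π) + 1/4`, `a(3,3) = 23/(15π)` (diagonal `(1/π)Σ_{j≤n} 1/(2j−1)`,
the rest by harmonicity `Σ_e a(x+e) = 4a(x) + δ_{x0}`); `0` outside the table. -/
def aInfKT : ℕ → ℕ → ℝ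
  | 0, 0 => 0
  | 1, 0 => 1 / 4
  | 1, 1 => 1 / Real.pi
  | 2, 0 => 1 - 2 / Real.pi
  | 2, 1 => 2 / Real.pi - 1 / 4
  | 2, 2 => 4 / (3 * Real.pi)
  | 3, 0 => 17 / 4 - 12 / Real.pi
  | 3, 1 => 23 / (3 * Real.pi) - 2
  | 3, 2 => 2 / (3 * Real.pi) + 1 / 4
  | 3, 3 => 23 / (15 * Real.pi)
  | _, _ => 0

/-! ## Measured enclosures (targets of the analytic regime; diag_row.py, L = 16…1024) -/

/-- TORUS PERIODISATION LAW at `λ = 0`: `V (a_L(x,y;0) − a_∞(x,y)) = −(x²+y²)/4 + κ_r (x²+y²)²/V`, `|κ_r| ≤ 0.194` measured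
(the `−|r|²/4V` is the exact quadratic correction of the periodic Green's function; data `L² dev → −.5000, −2.0000, −4.4998`
for `(1,1),(2,2),(3,3)`).  Stated with `1/5`. -/
def TorusKernelQuadraticLaw : Prop :=
  16 ≤ L → ∀ x y : ℕ, y ≤ x → x ≤ 3 →
    |(L : ℝ) ^ 2 * (aKer L 0 ((x : ZMod L), (y : ZMod L)) - aInfKT x y) + ((x : ℝ) ^ 2 + (y : ℝ) ^ 2) / 4|
      ≤ ((x : ℝ) ^ 2 + (y : ℝ) ^ 2) ^ 2 / (5 * (L : ℝ) ^ 2)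

/-- HOLE₂(.75) REGIME WINDOW (`λ = (3/2)ε₁`, i.e. the walk resolvent at `λ* = ¾ε₁`): for `L ≥ 32` and `0 ≤ y ≤ x ≤ 3`,
`0 ≤ a_L(x,y;(3/2)ε₁) − a_∞(x,y) ≤ 24 ln L / L²` (measured `C_r = dev·L²/ln L ∈ [1.57, 22.9]`, decreasing in `L`; the
λ-increase dominates the `−|r|²/4V` periodisation). -/
def HoleTwoRegimeWindow : Prop :=
  32 ≤ L → ∀ x y : ℕ, y ≤ x → x ≤ 3 →
    0 ≤ aKer L (3 / 2 * eps1 L) ((x : ZMod L), (y : ZMod L)) - aInfKT x y ∧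
      aKer L (3 / 2 * eps1 L) ((x : ZMod L), (y : ZMod L)) - aInfKT x y ≤ 24 * Real.log L / (L : ℝ) ^ 2

/-- HOLE₂(.75) REGIME CAPACITY: `G̃_{(3/2)ε₁}(0) = ln L/(2π) + c_L`, `c_L = .40789, .40605, .40551, .40536, .40531, .40530` at
`L = 32, 64, 128, 256, 512, 1024` (decreasing).  Stated: `|G̃(0) − ln L/(2π) − 0.4053| ≤ 0.0002 + 3/L²` for `L ≥ 32`.
(The two-hole Birman–Schwinger capacity is `Λ = 2(G̃(0) − 1/(λV))` in walk units, memo §314–§315.) -/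
def GzeroHoleTwoRegime : Prop :=
  32 ≤ L → |Gres L (3 / 2 * eps1 L) 0 - Real.log L / (2 * Real.pi) - 0.4053| ≤ 0.0002 + 3 / (L : ℝ) ^ 2

/-! ## Small proved consequences -/

/-- the axis value follows from harmonicity at `x = 0` once the four neighbours are identified (here recorded as the
implication with the symmetry supplied as a hypothesis). -/
theorem kernelAxisValue_of_harmonicity (hH : KernelHarmonicity L)
    (hsym : ∀ lam2 : ℝ, ∀ e ∈ nnList L, aKer L lam2 e = aKer L lam2 ((1 : ZMod L), 0))
    (hnn : nnList L = [((1 : ZMod L), 0), (-1, 0), (0, 1), (0, -1)])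
    (ha0 : ∀ lam2 : ℝ, aKer L lam2 0 = 0) :
    KernelAxisValue L := by
  intro lam2 h0 h1
  have h := hH lam2 h0 h1 0
  simp only [zero_add, if_true] at h
  rw [hnn] at h hsym
  simp only [List.map_cons, List.map_nil, List.sum_cons, List.sum_nil, add_zero] at h
  have e2 := hsym lam2 (-1, 0) (by simp)
  have e3 := hsym lam2 (0, 1) (by simp)
  have e4 := hsym lam2 (0, -1) (by simp)
  rw [e2, e3, e4, ha0 lam2] at h
  linarith

/-! ## PartN37 v2 (memo 21 §329): TORUS DIFFERENCE BOUNDS for the walk kernel `a = 2·aKer` at the HOLE₂ point `lam2 = (3/2)ε₁` —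
the one L-uniform analytic input of the far-pair ONE-HOLE COMPARISON (§329(b)–(d)). Measured maxima (L = 128…2048, all directions,
profiles are functions of r/L): |∇a|·|r| ≤ .883, |δ²_axis a|·|r|² ≤ 5.37 (4.05 at the antipode for L = 2048), |δ²_mixed a|·|r|² ≤ .548;
NEAR regime |r|∞ ≤ L/16: .402 / .392 / .488; MID |r| ≤ L/4: .825 / 1.043 / .488. Stated with slack. Proof route: the exact 1D row formula
(`GRowFormula`, PartN35) — x-differences hit `cos(θ m x)` (factor `2 sin(θm/2)` / `2(1 − cos θm)` per order), y-differences hit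
`cosh((L/2−y)μ_m)`; split m ≤ M₀ (explicit) / m > M₀ (geometric rows), as in LEMMA A0/A1 (PartN38). -/

/-- walk kernel at the HOLE₂ point as a function of integer coordinates. -/
def aWalk (x y : ℤ) : ℝ := 2 * aKer L (3 / 2 * eps1 L) (((x : ZMod L)), ((y : ZMod L)))

/-- squared Euclidean length of the canonical representative (hypotheses below keep |x|,|y| ≤ L/2). -/
def rsq (x y : ℤ) : ℝ := (x : ℝ) ^ 2 + (y : ℝ) ^ 2

/-- ★ TORUS GRADIENT BOUND (all r): `|a(r+e) − a(r)|·|r| ≤ 0.9` for `2 < |r|`, `|x|,|y| ≤ L/2`, `L ≥ 128`. -/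
def TorusGradientBound : Prop :=
  128 ≤ L → ∀ x y : ℤ, 2 * |x| ≤ (L : ℤ) → 2 * |y| ≤ (L : ℤ) → 4 < rsq x y →
    (|aWalk L (x + 1) y - aWalk L x y|) ^ 2 * rsq x y ≤ 0.9 ^ 2 ∧
    (|aWalk L x (y + 1) - aWalk L x y|) ^ 2 * rsq x y ≤ 0.9 ^ 2

/-- ★ TORUS HESSIAN BOUND (all r): axis second differences `·|r|² ≤ 5.5`, mixed `·|r|² ≤ 0.6`. -/
def TorusHessianBound : Prop :=
  128 ≤ L → ∀ x y : ℤ, 2 * |x| ≤ (L : ℤ) → 2 * |y| ≤ (L : ℤ) → 4 < rsq x y →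
    |aWalk L (x + 1) y + aWalk L (x - 1) y - 2 * aWalk L x y| * rsq x y ≤ 5.5 ∧
    |aWalk L x (y + 1) + aWalk L x (y - 1) - 2 * aWalk L x y| * rsq x y ≤ 5.5 ∧
    |aWalk L (x + 1) (y + 1) - aWalk L (x + 1) y - aWalk L x (y + 1) + aWalk L x y| * rsq x y ≤ 0.6

/-- ★ NEAR-REGIME BOUNDS (`|x|,|y| ≤ L/16`, ℤ²-like constants): gradient `≤ .42`, axis second `≤ .41`, mixed `≤ .5`. -/
def TorusHessianNear : Prop :=
  128 ≤ L → ∀ x y : ℤ, 16 * |x| ≤ (L : ℤ) → 16 * |y| ≤ (L : ℤ) → 4 < rsq x y →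
    (|aWalk L (x + 1) y - aWalk L x y|) ^ 2 * rsq x y ≤ 0.42 ^ 2 ∧
    (|aWalk L x (y + 1) - aWalk L x y|) ^ 2 * rsq x y ≤ 0.42 ^ 2 ∧
    |aWalk L (x + 1) y + aWalk L (x - 1) y - 2 * aWalk L x y| * rsq x y ≤ 0.41 ∧
    |aWalk L x (y + 1) + aWalk L x (y - 1) - 2 * aWalk L x y| * rsq x y ≤ 0.41 ∧
    |aWalk L (x + 1) (y + 1) - aWalk L (x + 1) y - aWalk L x (y + 1) + aWalk L x y| * rsq x y ≤ 0.5

/-- MID-REGIME BOUNDS (`x² + y² ≤ L²/16`): gradient `≤ .85`, axis second `≤ 1.1`, mixed `≤ .5`. -/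
def TorusHessianMid : Prop :=
  128 ≤ L → ∀ x y : ℤ, 16 * rsq x y ≤ (L : ℝ) ^ 2 → 4 < rsq x y →
    (|aWalk L (x + 1) y - aWalk L x y|) ^ 2 * rsq x y ≤ 0.85 ^ 2 ∧
    (|aWalk L x (y + 1) - aWalk L x y|) ^ 2 * rsq x y ≤ 0.85 ^ 2 ∧
    |aWalk L (x + 1) y + aWalk L (x - 1) y - 2 * aWalk L x y| * rsq x y ≤ 1.1 ∧
    |aWalk L x (y + 1) + aWalk L x (y - 1) - 2 * aWalk L x y| * rsq x y ≤ 1.1 ∧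
    |aWalk L (x + 1) (y + 1) - aWalk L (x + 1) y - aWalk L x (y + 1) + aWalk L x y| * rsq x y ≤ 0.5

end Summit.HubbardSuperconductivity.HubbardSuperconductivity.Theorems.AnisotropyChord.Transfer.Fibre3

end
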